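import Literature.Topology.PlaneTopology.WindingNumber
import HarnessLib

/-!
# The winding number of the `d`-fold loop

Topic: Topology / PlaneTopology, sequel to `WindingNumber.lean`. For a continuous nowhere-zero
`1`-periodic `f : ℝ → ℂ` and `d ∈ ℤ`, **the loop `u ↦ f (d u)` read on `[0, 1]` winds `d` times
as much as `f`**: `wind (f (d ·)) = d · wind f` (`wind_comp_intCast_mul`). A global logarithm `l`
of `f` on `ℝ` gains `2πi · wind f` over each period, hence `2πi · d · wind f` from `0` to `d`.
Used to read the degree of a loop of a closed leaf (a power of its injective loop,
`PlanarFoliations/CirclePowers.lean`) on plane winding numbers.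

All statements are [folklore].
-/

noncomputable section

open Set Function Complex
open scoped Real

namespace Literature.Topology.PlaneTopology

/-- **Winding number of the `d`-fold loop**: `wind (u ↦ f (d u)) = d · wind f` for `f` continuous,
nowhere zero and `1`-periodic. [folklore] -/
theorem wind_comp_intCast_mul {f : ℝ → ℂ} (hf : Continuous f) (hne : ∀ t, f t ≠ 0) (hp : Periodic f 1) (d : ℤ) :
    wind (fun u ↦ f (d * u)) = d * wind f := by
  obtain ⟨l, hl, hle⟩ := hasLogOn_univ isSimplyConnected_univ_real hf hne
  have hlc : Continuous l := continuousOn_univ.1 hl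
  have hle' : ∀ t, exp (l t) = f t := fun t ↦ hle t (mem_univ t)
  -- `l (· + 1) = l + 2πi n`
  obtain ⟨n, hn⟩ := exists_int_eq_add_of_exp_eq isPreconnected_univ (l := fun t ↦ l (t + 1)) (m := l)
    ((hlc.comp (continuous_id.add continuous_const)).continuousOn) hl
    (fun t _ ↦ show exp (l (t + 1)) = exp (l t) by rw [hle', hle', hp t])
  have h01 : f 0 = f 1 := by have := hp 0; rw [zero_add] at this; exact this.symm
  have hw : l 1 - l 0 = wind f * (2 * π * I) := wind_spec hlc.continuousOn (fun t _ ↦ hle' t) h01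
  have hn0 : l 1 = l 0 + n * (2 * π * I) := by have := hn 0 (mem_univ 0); rwa [zero_add] at this
  have hnw : n = wind f := by
    apply int_eq_of_mul_two_pi_I_eq
    rw [← hw, hn0]; ring
  -- telescoping over the periods: `l k = l 0 + k · 2πi n` for `k ∈ ℤ`
  have htel : ∀ k : ℤ, l k = l 0 + k * (n * (2 * π * I)) := by
    intro k
    induction k using Int.induction_on with
    | zero => simp
    | succ k ih =>
      have h := hn ((k : ℤ) : ℝ) (mem_univ _)
      rw [show (((k : ℤ) + 1 : ℤ) : ℝ) = ((k : ℤ) : ℝ) + 1 by push_cast; ring, h, ih]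
      push_cast; ring
    | pred k ih =>
      have h := hn ((-(k : ℤ) - 1 : ℤ) : ℝ) (mem_univ _)
      rw [show ((-(k : ℤ) - 1 : ℤ) : ℝ) + 1 = ((-(k : ℤ) : ℤ) : ℝ) by push_cast; ring, ih] at h
      -- `h : l 0 + (-k) * c = l (-k - 1) + n * c`
      rw [show l ((-(k : ℤ) - 1 : ℤ) : ℝ) = l 0 + ((-(k : ℤ) : ℤ) : ℂ) * (n * (2 * π * I)) - n * (2 * π * I) by
        rw [h]; ring]
      push_cast; ring
  -- the `d`-fold loop and its logarithm `u ↦ l (d u)`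
  have hd01 : f (d * (0 : ℝ)) = f (d * (1 : ℝ)) := by
    rw [mul_zero, mul_one]
    have := (hp.int_mul d) 0
    rw [zero_add, mul_one] at this
    exact this.symm
  have hw' : l (d * (1 : ℝ)) - l (d * (0 : ℝ)) = wind (fun u ↦ f (d * u)) * (2 * π * I) :=
    wind_spec (f := fun u ↦ f (d * u)) (l := fun u ↦ l (d * u)) ((hlc.comp (continuous_const.mul continuous_id)).continuousOn)
      (fun t _ ↦ hle' (d * t)) hd01
  rw [mul_one, mul_zero, htel d] at hw'
  apply int_eq_of_mul_two_pi_I_eq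
  rw [← hw', ← hnw]; push_cast; ring

end Literature.Topology.PlaneTopology
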